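import Literature.MathematicalPhysics.QuantumFieldTheory.Federbush1986.PhaseCellIVThmA2Embedded

/-!
# Federbush, *A phase cell approach to Yang–Mills theory. IV. The choice of variables* (CMP **114** (1988) 317–343) —
# Appendix A, part A «Geometric Constructions 1 and 3»: THEOREM A.1 (A.1)–(A.2) p. 339 under the EMBEDDED reading `M ⊆ Rᵗ`,
# typed at every cap `c₁`, and its SMALL-DATA clause PROVED: for every uniformly Lipschitz-retractable `M` there is a
# `c₁ > 0` (explicit) for which the conclusion of Theorem A.1 holds — no homotopy needed in that regime — in particular
# for the model targets `S^{t−1}` (U(1), SU(2))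

statement-level skeleton of published theorems with citation tags; proofs where landed; nothing here is a claim about the Yang–Mills mass gap

Cell `lit-balaban`, reader/typer block **r19** (F4 fold owner), SKELETON row `F4.ThmA.1` (and `F4.EqA.3-A.5`, `F4.EqA.9-A.16`)
of `run/shared/lean/pub/lit-balaban/lit-balaban-r19/ROWS-F4.md`.

**Source.** P. Federbush, Commun. Math. Phys. **114** (1988) 317–343 [bib `Federbush1988PhaseCellIV`; doi:10.1007/bf01225039;
lit store `paper:doi-10-1007-bf01225039`; journal page = PDF page + 316], pp. 339–340 [PDF 23–24] read as images (renders
`lit-balaban-r19/renders/f4/f4-p023.png`, `f4-p024.png`).  Verbatim, p. 339: «Let `M` be a compact differentiable manifold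
(without boundary) and provided with a Riemannian metric. Let `D` be the unit `n`-cube, `D = {0 ≤ x_i ≤ 1}`. Define `Λ₁` as
defined after (11.4), on any mapping from a subset of `D` into `M`.  **Theorem A.1.** For each constant `c₁`, there is a constant
`c₂ = c₂(c₁)`, such that if `f` is any homotopically trivial mapping from `∂D` into `M` satisfying `Λ₁(f) ≤ c₁` (A.1) there is an
extension of `f`, `f^e`, mapping `D` into `M`, satisfying `Λ₁(f^e) ≤ c₂Λ₁(f)` (A.2).  We do not know if the limitation in (A.1)
is necessary, whether there may not be a universal `c₂`.»  Proof, p. 339–340: «if `f : ∂D → Rˢ` (A.3), then there is an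
extension `f^e : D → Rˢ` (A.4) satisfying `Λ₁(f^e) ≤ c(s)Λ₁(f)` (A.5).  Moreover if the image of `f` lies in a cube, `f^e` can be
chosen so that the image of `f^e` lies in the same cube» (PROVED as `extend_euclidean_box`, p242861), followed by the simplicial
steps 1)–4), (A.9)–(A.16), «we hold these truths to be self-evident».  §11 p. 337: «In favorable circumstances the `φ′ᵢ(x)` will be
nearly constant on the vertices, and easier to interpolate smoothly than the `φᵢ(x)`.»

**What this file does.**
* The decl of record `PhaseCellIVAppA.ThmA1` (p242861) is typed over Mathlib's abstract `IsRiemannianManifold` class (no compact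
  instance in Mathlib).  As for Theorem A.2 (`ThmA2Emb`, p263972), `ThmA1EmbAt n t M c₁` / `ThmA1Emb n t M` re-read Theorem A.1 for an
  embedded target `M ⊆ Rᵗ` with the ambient distance — word for word `ThmA1` otherwise (`D`, `∂D` = `unitCube`, `cubeBoundary`;
  «homotopically trivial» = `ContinuousMap.Nullhomotopic`; «for each `c₁` there is `c₂ = c₂(c₁)`» = `∀ c₁, ∃ c₂`, with
  `ThmA1EmbAt … c₁` the clause at one cap `c₁`, antitone in `c₁`).
* `thmA1EmbAt_of_retract`: **the small-data clause is PROVED** — if `P` is an `L`-Lipschitz retraction of the open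
  `r`-neighbourhood of `M` onto `M`, then `ThmA1EmbAt n t M c₁` holds for the explicit cap `c₁ = r/(2(√t√n + 1))` (hence for every
  smaller cap), with `c₂ = L·√t`: a map `f : ∂D → M` with `Λ₁(f) ≤ c₁` has image in the ball of radius `√n Λ₁(f)` about `f(x₀)`;
  print's own first step (A.3)–(A.5) with the cube clause (`extend_euclidean_box`) extends it to `g : D → Rᵗ` inside the coordinate
  box of that ball, so `dist(g(x), M) ≤ √t√n Λ₁(f) < r`, and `f^e := P ∘ g` is the extension, `Λ₁(f^e) ≤ L√t Λ₁(f)`.  In this regime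
  the homotopy hypothesis is not used (small Lipschitz data into a uniformly locally contractible target are automatically
  null-homotopic); the clause for LARGE `c₁` — print's simplicial steps (A.9)–(A.16) — is NOT proved here.
* `thmA1EmbAt_sphere`: the model targets `S^{t−1} ⊂ ℝᵗ`, `t ≥ 1`, hypothesis-free (`r = ½`, `L = 4`: cap `c₁ = 1/(4(√t√n + 1))`,
  `c₂ = 4√t`); `U(1) = S¹`, `SU(2) ≅ S³`.
-/

namespace Literature.MathematicalPhysics.QuantumFieldTheory.Federbush1986

noncomputable section

open scoped NNReal ENNReal
open Set Metric

namespace PhaseCellIVAppA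

/-! ## 1. Theorem A.1 under the embedded reading, at a fixed cap `c₁` and for all caps -/

/-- **Theorem A.1 at the cap `c₁`** (embedded reading): «there is a constant `c₂ = c₂(c₁)`, such that if `f` is any
homotopically trivial mapping from `∂D` into `M` satisfying `Λ₁(f) ≤ c₁` (A.1) there is an extension of `f`, `f^e`, mapping `D`
into `M`, satisfying `Λ₁(f^e) ≤ c₂Λ₁(f)` (A.2)», the target being a set `M ⊆ EuclideanSpace ℝ (Fin t)` with the ambient distance
(as `ThmA2Emb`, `ThmA3`, `ThmA4`), `D`/`∂D` = `unitCube n`/`cubeBoundary n`, `f` a continuous map, «homotopically trivial» =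
`ContinuousMap.Nullhomotopic`, (A.1)/(A.2) in `ℝ≥0∞` via `lipConst`.  `Prop`-valued definition.
[cite: Federbush1988PhaseCellIV, Theorem A.1 (A.1)–(A.2) p. 339] -/
def ThmA1EmbAt (n t : ℕ) (M : Set (EuclideanSpace ℝ (Fin t))) (c₁ : ℝ≥0) : Prop :=
  ∃ c₂ : ℝ≥0, ∀ f : C(↥(cubeBoundary n), ↥M), f.Nullhomotopic → lipConst f ≤ c₁ →
    ∃ fe : ↥(unitCube n) → ↥M,
      (∀ x : ↥(cubeBoundary n), fe ⟨x.1, cubeBoundary_subset n x.2⟩ = f x) ∧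
      lipConst fe ≤ c₂ * lipConst f

/-- **Theorem A.1** (embedded reading): «For each constant `c₁`, there is a constant `c₂ = c₂(c₁)` …» = the clause `ThmA1EmbAt`
at every cap.  Word for word the record statement `ThmA1` with the abstract Riemannian manifold replaced by the embedded
`M ⊆ Rᵗ`.  `Prop`-valued definition, NOT asserted (only its small-`c₁` clauses are proved below).
[cite: Federbush1988PhaseCellIV, Theorem A.1 (A.1)–(A.2) p. 339] -/
def ThmA1Emb (n t : ℕ) (M : Set (EuclideanSpace ℝ (Fin t))) : Prop :=
  ∀ c₁ : ℝ≥0, ThmA1EmbAt n t M c₁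

/-- The clauses are antitone in the cap: `c₂(c₁)` serves every `c₁′ ≤ c₁`. [cite: Federbush1988PhaseCellIV, Theorem A.1 p. 339] -/
theorem ThmA1EmbAt.anti {n t : ℕ} {M : Set (EuclideanSpace ℝ (Fin t))} {c₁ c₁' : ℝ≥0} (hle : c₁' ≤ c₁)
    (h : ThmA1EmbAt n t M c₁) : ThmA1EmbAt n t M c₁' := by
  obtain ⟨c₂, hc⟩ := h
  exact ⟨c₂, fun f hf hΛ => hc f hf (hΛ.trans (by exact_mod_cast hle))⟩

namespace ThmA1Small

/-! ## 2. Two size estimates in `ℝᵗ` and in the unit cube -/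

/-- `|z| ≤ √t · B` when every coordinate of `z ∈ Rᵗ` is bounded by `B` (the passage from print's coordinate cube to the
Euclidean ball). [cite: Federbush1988PhaseCellIV, (A.5) p. 340] -/
theorem norm_le_sqrt_mul {t : ℕ} (z : EuclideanSpace ℝ (Fin t)) {B : ℝ} (hB : 0 ≤ B) (h : ∀ i, ‖z i‖ ≤ B) :
    ‖z‖ ≤ Real.sqrt t * B := by
  rw [EuclideanSpace.norm_eq]
  have hsum : ∑ i, ‖z i‖ ^ 2 ≤ (t : ℝ) * B ^ 2 := by
    calc ∑ i, ‖z i‖ ^ 2 ≤ ∑ _i : Fin t, B ^ 2 :=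
          Finset.sum_le_sum fun i _ => pow_le_pow_left₀ (norm_nonneg _) (h i) 2
      _ = (t : ℝ) * B ^ 2 := by simp
  calc Real.sqrt (∑ i, ‖z i‖ ^ 2) ≤ Real.sqrt ((t : ℝ) * B ^ 2) := Real.sqrt_le_sqrt hsum
    _ = Real.sqrt t * B := by rw [Real.sqrt_mul (Nat.cast_nonneg t), Real.sqrt_sq hB]

/-- The unit cube `D` has diameter `≤ √n`. [cite: Federbush1988PhaseCellIV, Theorem A.1 p. 339] -/
theorem dist_le_sqrt_of_mem_unitCube {n : ℕ} {x y : EuclideanSpace ℝ (Fin n)} (hx : x ∈ unitCube n) (hy : y ∈ unitCube n) :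
    dist x y ≤ Real.sqrt n := by
  rw [dist_eq_norm]
  have h := norm_le_sqrt_mul (x - y) zero_le_one fun i => by
    have hxi := hx i
    have hyi := hy i
    rw [PiLp.sub_apply, Real.norm_eq_abs, abs_le]
    constructor <;> linarith [hxi.1, hxi.2, hyi.1, hyi.2]
  simpa using h

end ThmA1Small

/-! ## 3. The small-data clause of Theorem A.1 for uniformly Lipschitz-retractable targets -/

open ThmA1Small ThmA2 in
/-- **Theorem A.1 (embedded reading), SMALL-DATA CLAUSE, PROVED**: if `P` is an `L`-Lipschitz retraction of the open
`r`-neighbourhood `{y | dist(y, M) < r}` onto `M` (`P = id` on `M`), then `ThmA1EmbAt n t M c₁` holds at the cap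
`c₁ = r/(2(√t√n + 1))` with `c₂ = L√t`: `f^e := P ∘ g`, `g` = print's coordinatewise extension (A.3)–(A.5) with the cube clause
(`extend_euclidean_box`), whose image stays within `√t√n Λ₁(f) < r` of `f(x₀) ∈ M`.  The homotopy hypothesis is not needed in
this regime; the clause for large `c₁` (steps (A.9)–(A.16)) is not proved here.
[cite: Federbush1988PhaseCellIV, Theorem A.1 (A.1)–(A.5) pp. 339–340] -/
theorem thmA1EmbAt_of_retract {t : ℕ} {M : Set (EuclideanSpace ℝ (Fin t))} {r : ℝ} (hr : 0 < r) {L : ℝ≥0}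
    {P : EuclideanSpace ℝ (Fin t) → EuclideanSpace ℝ (Fin t)} (hPL : LipschitzOnWith L P {y | infDist y M < r})
    (hPM : MapsTo P {y | infDist y M < r} M) (hPid : ∀ y ∈ M, P y = y) (n : ℕ) :
    ∃ c₁ : ℝ≥0, 0 < c₁ ∧ ThmA1EmbAt n t M c₁ := by
  classical
  -- the cap and the constant
  have hden : 0 < 2 * (Real.sqrt t * Real.sqrt n + 1) := by positivity
  set c₁r : ℝ := r / (2 * (Real.sqrt t * Real.sqrt n + 1)) with hc₁r
  have hc₁pos : 0 < c₁r := div_pos hr hden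
  have hc₁small : Real.sqrt t * Real.sqrt n * c₁r ≤ r / 2 := by
    rw [hc₁r, mul_div_assoc', div_le_iff₀ hden]
    nlinarith [Real.sqrt_nonneg t, Real.sqrt_nonneg n, mul_nonneg (Real.sqrt_nonneg t) (Real.sqrt_nonneg n)]
  set Ct : ℝ≥0 := (Fintype.card (Fin t) : ℝ≥0) ^ (1 / (2 : ℝ≥0∞)).toReal with hCt
  refine ⟨⟨c₁r, hc₁pos.le⟩, by rw [← NNReal.coe_pos]; exact hc₁pos, L * Ct, fun f _ hΛ => ?_⟩
  -- `Λ₁(f) = K < ∞`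
  have hΛtop : lipConst f ≠ ⊤ := ne_top_of_le_ne_top ENNReal.coe_ne_top hΛ
  set K : ℝ≥0 := (lipConst f).toNNReal with hK_def
  have hKe : lipConst (f : ↥(cubeBoundary n) → ↥M) = K := (ENNReal.coe_toNNReal hΛtop).symm
  have hfL : LipschitzWith K f := lipConst_le_iff.mp hKe.le
  have hKc : (K : ℝ) ≤ c₁r := by
    have : K ≤ ⟨c₁r, hc₁pos.le⟩ := by rw [← ENNReal.coe_le_coe, ← hKe]; exact hΛ
    exact this
  rcases (cubeBoundary n).eq_empty_or_nonempty with h0 | ⟨x₀, hx₀⟩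
  · -- `∂D = ∅` (`n = 0`): a constant extension
    rcases M.eq_empty_or_nonempty with hM | ⟨m, hm⟩
    · exfalso
      have : (0 : EuclideanSpace ℝ (Fin t)) ∈ {y | infDist y M < r} := by
        show infDist 0 M < r
        rw [hM, infDist_empty]
        exact hr
      have h := hPM this
      rw [hM] at h
      exact h
    · refine ⟨fun _ => ⟨m, hm⟩, fun x => ?_, ?_⟩
      · have : x.1 ∈ (∅ : Set (EuclideanSpace ℝ (Fin n))) := h0 ▸ x.2
        exact this.elim
      · calc lipConst (fun _ : ↥(unitCube n) => (⟨m, hm⟩ : ↥M)) ≤ ((0 : ℝ≥0) : ℝ≥0∞) :=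
              lipConst_le_of_lipschitzWith (LipschitzWith.const _)
          _ ≤ _ := by rw [ENNReal.coe_zero]; exact zero_le
  · -- main case
    set p₀ : EuclideanSpace ℝ (Fin t) := (f ⟨x₀, hx₀⟩ : EuclideanSpace ℝ (Fin t)) with hp₀
    have hp₀M : p₀ ∈ M := (f ⟨x₀, hx₀⟩).2
    -- ambient representative of `f`
    set F : EuclideanSpace ℝ (Fin n) → EuclideanSpace ℝ (Fin t) :=
      fun x => if h : x ∈ cubeBoundary n then (f ⟨x, h⟩ : EuclideanSpace ℝ (Fin t)) else p₀ with hF_def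
    have hFf : ∀ (x : EuclideanSpace ℝ (Fin n)) (hx : x ∈ cubeBoundary n), F x = f ⟨x, hx⟩ := fun x hx => by
      rw [hF_def]
      exact dif_pos hx
    have hFL : LipschitzOnWith K F (cubeBoundary n) := lipschitzOnWith_of_subtype hfL hFf
    -- the image of `∂D` lies within `K√n` of `p₀`, coordinatewise
    have hFclose : ∀ x ∈ cubeBoundary n, ‖F x - p₀‖ ≤ K * Real.sqrt n := by
      intro x hx
      calc ‖F x - p₀‖ = dist (F x) (F x₀) := by rw [dist_eq_norm, hFf x₀ hx₀]
        _ ≤ K * dist x x₀ := hFL.dist_le_mul x hx x₀ hx₀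
        _ ≤ K * Real.sqrt n := by
            gcongr
            exact dist_le_sqrt_of_mem_unitCube (cubeBoundary_subset n hx) (cubeBoundary_subset n hx₀)
    have hKn : 0 ≤ (K : ℝ) * Real.sqrt n := by positivity
    have hab : ∀ i : Fin t, p₀ i - K * Real.sqrt n ≤ p₀ i + K * Real.sqrt n := fun i => by linarith
    have hbox : ∀ x ∈ cubeBoundary n, ∀ i : Fin t, F x i ∈ Icc (p₀ i - K * Real.sqrt n) (p₀ i + K * Real.sqrt n) := by
      intro x hx i
      have h1 : ‖(F x - p₀) i‖ ≤ ‖F x - p₀‖ := PiLp.norm_apply_le (F x - p₀) i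
      rw [PiLp.sub_apply, Real.norm_eq_abs] at h1
      have h2 := h1.trans (hFclose x hx)
      rw [abs_le] at h2
      constructor <;> linarith [h2.1, h2.2]
    -- print's (A.3)–(A.5) with the cube clause
    obtain ⟨g, hgL, hgeq, hgbox⟩ := extend_euclidean_box hFL hab hbox
    have hgclose : ∀ x : EuclideanSpace ℝ (Fin n), ‖g x - p₀‖ ≤ Real.sqrt t * (K * Real.sqrt n) := fun x =>
      norm_le_sqrt_mul (g x - p₀) hKn fun i => by
        rw [PiLp.sub_apply, Real.norm_eq_abs, abs_le]
        have h := hgbox x i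
        constructor <;> linarith [h.1, h.2]
    have hgU : ∀ x : EuclideanSpace ℝ (Fin n), g x ∈ {y | infDist y M < r} := fun x => by
      show infDist (g x) M < r
      calc infDist (g x) M ≤ dist (g x) p₀ := infDist_le_dist_of_mem hp₀M
        _ ≤ Real.sqrt t * (K * Real.sqrt n) := by rw [dist_eq_norm]; exact hgclose x
        _ = Real.sqrt t * Real.sqrt n * K := by ring
        _ ≤ Real.sqrt t * Real.sqrt n * c₁r := by gcongr
        _ ≤ r / 2 := hc₁small
        _ < r := by linarith
    -- the extension `f^e = P ∘ g`
    refine ⟨fun x => ⟨P (g x.1), hPM (hgU x.1)⟩, fun x => ?_, ?_⟩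
    · apply Subtype.ext
      show P (g x.1) = (f x : EuclideanSpace ℝ (Fin t))
      rw [← hgeq x.2, hFf x.1 x.2, hPid _ (f x).2]
    · have hfe : LipschitzWith (L * (Ct * K)) (fun x : ↥(unitCube n) => (⟨P (g x.1), hPM (hgU x.1)⟩ : ↥M)) := by
        refine LipschitzWith.of_dist_le_mul fun x y => ?_
        rw [Subtype.dist_eq, Subtype.dist_eq x]
        calc dist (P (g x.1)) (P (g y.1)) ≤ L * dist (g x.1) (g y.1) := hPL.dist_le_mul _ (hgU x.1) _ (hgU y.1)
          _ ≤ L * ((Ct * K : ℝ≥0) * dist x.1 y.1) := by gcongr; exact hgL.dist_le_mul x.1 y.1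
          _ = (L * (Ct * K) : ℝ≥0) * dist x.1 y.1 := by push_cast; ring
      calc lipConst _ ≤ ((L * (Ct * K) : ℝ≥0) : ℝ≥0∞) := lipConst_le_of_lipschitzWith hfe
        _ = (L * Ct : ℝ≥0) * lipConst (f : ↥(cubeBoundary n) → ↥M) := by
            rw [hKe]
            push_cast
            ring

open ThmA2 in
/-- **Theorem A.1 (embedded reading), small-data clause, for the MODEL TARGETS `S^{t−1} ⊂ ℝᵗ`** (`t ≥ 1`; radial retraction
`r = ½`, `L = 4`): `ThmA1EmbAt n t (sphere 0 1) c₁` for an explicit `c₁ > 0`, every cube dimension `n` — in particular for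
`U(1) = S¹` and `SU(2) ≅ S³`. [cite: Federbush1988PhaseCellIV, Theorem A.1 (A.1)–(A.2) p. 339] -/
theorem thmA1EmbAt_sphere (n : ℕ) {t : ℕ} (ht : 1 ≤ t) :
    ∃ c₁ : ℝ≥0, 0 < c₁ ∧ ThmA1EmbAt n t (sphere (0 : EuclideanSpace ℝ (Fin t)) 1) c₁ := by
  obtain ⟨hL, hM, hid⟩ := ThmA2.radial_retraction_sphere ht
  exact thmA1EmbAt_of_retract (by norm_num : (0 : ℝ) < 1 / 2) hL hM hid n

/-- `U(1) = S¹`: the small-data clause of Theorem A.1 on the circle. [cite: Federbush1988PhaseCellIV, Theorem A.1 p. 339] -/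
theorem thmA1EmbAt_circle (n : ℕ) : ∃ c₁ : ℝ≥0, 0 < c₁ ∧ ThmA1EmbAt n 2 (sphere (0 : EuclideanSpace ℝ (Fin 2)) 1) c₁ :=
  thmA1EmbAt_sphere n (by norm_num)

/-- `SU(2) ≅ S³`: the small-data clause of Theorem A.1 on the three-sphere. [cite: Federbush1988PhaseCellIV, Theorem A.1 p. 339] -/
theorem thmA1EmbAt_threeSphere (n : ℕ) : ∃ c₁ : ℝ≥0, 0 < c₁ ∧ ThmA1EmbAt n 4 (sphere (0 : EuclideanSpace ℝ (Fin 4)) 1) c₁ :=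
  thmA1EmbAt_sphere n (by norm_num)

/-! ## 4. (v1.1) Print's reduction of Theorem A.1 to the large-data bound (A.9)–(A.10), p. 340 -/

/-- p. 339–340, verbatim: «*Proof.* There is an `ε > 0`, such that if `Λ₁(f) < ε`, then the image of `f` lies in a piece of the
manifold diffeomorphic to a cube in Euclidean space. … Thus if (A.2) holds for mappings into `M′ = Rˢ` for some constant `c` …,
then (A.2) will hold in the context of the theorem for some constant `c′`, for mappings satisfying `Λ₁(f) ≤ ε`. … With the
considerations above for the situation with `Λ₁(f) < ε`, the proof of Theorem A.1 is now reduced to proving the existence of a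
`c′₂(c₁)` so that if `Λ₁(f) ≤ c₁` (A.9), `f^e` may be found satisfying `Λ₁(f^e) ≤ c′₂` (A.10).»  THE REDUCTION, PROVED (pure
bookkeeping, embedded reading): the small-data clause at the cap `ε > 0` with constant `c_s`, together with an ABSOLUTE bound
`c′₂` for the extensions of the maps with `ε ≤ Λ₁(f) ≤ c₁`, give the clause of Theorem A.1 at the cap `c₁` with
`c₂ = max(c_s, c′₂/ε)` (for `Λ₁(f) ≥ ε`, `c′₂ = (c′₂/ε)·ε ≤ (c′₂/ε)·Λ₁(f)`).
[cite: Federbush1988PhaseCellIV, (A.9)–(A.10) p. 340; p. 339] -/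
theorem thmA1EmbAt_of_small_of_large {n t : ℕ} {M : Set (EuclideanSpace ℝ (Fin t))} {ε c₁ cs cl : ℝ≥0} (hε : 0 < ε)
    (hsmall : ∀ f : C(↥(cubeBoundary n), ↥M), f.Nullhomotopic → lipConst f ≤ ε →
      ∃ fe : ↥(unitCube n) → ↥M, (∀ x : ↥(cubeBoundary n), fe ⟨x.1, cubeBoundary_subset n x.2⟩ = f x) ∧
        lipConst fe ≤ cs * lipConst f)
    (hlarge : ∀ f : C(↥(cubeBoundary n), ↥M), f.Nullhomotopic → (ε : ℝ≥0∞) ≤ lipConst f → lipConst f ≤ c₁ →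
      ∃ fe : ↥(unitCube n) → ↥M, (∀ x : ↥(cubeBoundary n), fe ⟨x.1, cubeBoundary_subset n x.2⟩ = f x) ∧
        lipConst fe ≤ cl) :
    ThmA1EmbAt n t M c₁ := by
  refine ⟨max cs (cl / ε), fun f hf hΛ => ?_⟩
  rcases le_or_gt (lipConst (f : ↥(cubeBoundary n) → ↥M)) ε with hs | hl
  · obtain ⟨fe, hext, hfe⟩ := hsmall f hf hs
    refine ⟨fe, hext, hfe.trans ?_⟩
    gcongr
    exact_mod_cast le_max_left cs (cl / ε)
  · obtain ⟨fe, hext, hfe⟩ := hlarge f hf hl.le hΛ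
    refine ⟨fe, hext, hfe.trans ?_⟩
    calc (cl : ℝ≥0∞) = (cl / ε : ℝ≥0) * (ε : ℝ≥0∞) := by
          rw [← ENNReal.coe_mul, div_mul_cancel₀ cl hε.ne']
      _ ≤ (max cs (cl / ε) : ℝ≥0) * lipConst (f : ↥(cubeBoundary n) → ↥M) := by
          gcongr
          exact_mod_cast le_max_right cs (cl / ε)

/-- **The reduction applied**: for a uniformly Lipschitz-retractable `M`, Theorem A.1 (embedded reading) at ANY cap `c₁` follows
from an absolute bound (A.10) for the homotopically trivial maps with `ε ≤ Λ₁(f) ≤ c₁`, `ε` = the small-data cap of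
`thmA1EmbAt_of_retract` — i.e. exactly print's remaining steps 1)–4), (A.11)–(A.16), which are NOT proved here.
[cite: Federbush1988PhaseCellIV, (A.9)–(A.16) pp. 340–341] -/
theorem thmA1EmbAt_of_retract_of_large {t : ℕ} {M : Set (EuclideanSpace ℝ (Fin t))} {r : ℝ} (hr : 0 < r) {L : ℝ≥0}
    {P : EuclideanSpace ℝ (Fin t) → EuclideanSpace ℝ (Fin t)} (hPL : LipschitzOnWith L P {y | infDist y M < r})
    (hPM : MapsTo P {y | infDist y M < r} M) (hPid : ∀ y ∈ M, P y = y) (n : ℕ) :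
    ∃ ε : ℝ≥0, 0 < ε ∧ ∀ c₁ cl : ℝ≥0,
      (∀ f : C(↥(cubeBoundary n), ↥M), f.Nullhomotopic → (ε : ℝ≥0∞) ≤ lipConst f → lipConst f ≤ c₁ →
        ∃ fe : ↥(unitCube n) → ↥M, (∀ x : ↥(cubeBoundary n), fe ⟨x.1, cubeBoundary_subset n x.2⟩ = f x) ∧
          lipConst fe ≤ cl) →
      ThmA1EmbAt n t M c₁ := by
  obtain ⟨ε, hε, cs, hsmall⟩ := thmA1EmbAt_of_retract hr hPL hPM hPid n
  exact ⟨ε, hε, fun c₁ cl hlarge => thmA1EmbAt_of_small_of_large hε hsmall hlarge⟩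

end PhaseCellIVAppA

end

end Literature.MathematicalPhysics.QuantumFieldTheory.Federbush1986
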